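import Mathlib
import HarnessLib
import Summits.HubbardSuperconductivity.HubbardSuperconductivity.Theorems.KLProgrammeKLRegimeEngineV8E5Share
import Summits.HubbardSuperconductivity.HubbardSuperconductivity.Theorems.KLProgrammeKLRegimeEngineV8TowerExports2

/-!
# Route `KLProgramme` — ENGINE child gen 8 (stmt-HubbardSuperconductivity-20437 `KLRegimeEngineV17F2`), SKELETON v2 class #3, SUCCESSOR MODULE
# of `…EngineV8E5Share` §2/§3 (plan g18 (R55c) sheet rev 1.2 §J: J1 successor with NEW names, J4 (k1); cell gate-hubbard-kl, seat p5 g8 = class-#3 owner)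

NAME MAP (old ↦ new): `E5ShareStep ↦ E5ShareStep2` · `IsE5Pkg ↦ IsE5Pkg2` · `klE5Pkg ↦ klE5Pkg2` · `klE5Raise ↦ klE5Raise2` · `klE5ShareU ↦ klE5ShareU2`
(threshold now `EngConsts → ℝ → ℝ`, read at the whole raised package) · bare twins `E5ShareStepBare ↦ E5ShareStepBare2`, `klE5PkgBare ↦ klE5PkgBare2`,
`klE5RaiseBare ↦ klE5RaiseBare2`, `klE5ShareUBare ↦ klE5ShareUBare2`.  The OBJECTS (`klE5Block`, `klE5BlockR1`, `klE5BlockBare`, the (R1′) symbols) are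
the landed ones — imported, not touched.

WHY A SUCCESSOR UNDER EVERY TOKEN TABLE (not only B′; finding of this seat, KL STATUS 2026-08-27 p5 g8): the landed `E5ShareStep`'s export hypothesis
`∀ j ≤ n, LevelsUExportAt L M (klCU P R (klEngQ7 P R)) P β U μ j` is (i) keyed at the SUPERSEDED deferred table `klCU` (token #20 renames the class-#1
table to `klCU2` at every site the v2 stubs produce it — nothing in v2 ever proves a `klCU`-keyed export) and (ii) THIN-only, while the `∃ (C,u)` witness
reads the MIXED rows (FINDING (E5-LABELS), J5).  So the step the v2 closer of stub (c) can feed, and whose witness is provable, is `E5ShareStep2` below;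
the engine package of v2 must read `klE5Raise2` (a further `CR`-raise of `klEngQ8`, k3c2-p1's Defs successor), and `klEngU₀11` reads `klE5ShareU2`.

* §1 **`E5ShareStep2 P R C u`** — `E5ShareStep` with: (k1) `∀ Q : EngConsts, (klEngQ7 P R).IsRaiseOf Q →` (history at `G P Q R`), door `U ≤ klEngU₀10 P R cc`,
  CE-aware threshold `U ≤ u Q cc`, volume `klEngL₄ P R β U ≤ L`, export hypothesis `∀ j ≤ n, LevelsUExportMixedAt L M (klCU2 P R (klEngQ7 P R)) P β U μ j`;
  conclusion VERBATIM (`‖klE5BlockR1 … (K_n) (n−1) Λ Qm x y‖·(Λ_{n−1} − Λ_n) ≤ C·(P.Klam·U)³·2^{−n}` over the bare ball);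
  `IsE5Pkg2`, dite `klE5Pkg2` (else `(0, 1)`: no scale-0 base reads it, so no F* is needed), **`klE5Raise2`**, **`klE5ShareU2`**, `klE5Raise2_nonneg`,
  `klE5ShareU2_pos`, **`e5ShareStep2_klE5Raise2_of_exists/_of`**, `E5ShareStep2.mono`;
* §2 the BARE-lines twin `E5ShareStepBare2` (over `klE5BlockBare`) with `klE5PkgBare2/klE5RaiseBare2/klE5ShareUBare2` (+ rows) — as in the landed
  module, so that either line organisation of the (c) lane needs no further definition.

Definitions with bodies + bookkeeping; nothing about the model's sizes is asserted; nothing asserts superconductivity.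
-/

noncomputable section

namespace Summit.HubbardSuperconductivity.HubbardSuperconductivity.Theorems.KLRegimeSplit

set_option linter.dupNamespace false -- summit = problem name (single-conjunct summit), D-0017

open Real Finset Literature.MathematicalPhysics.QuantumLattice Literature.Probability.LatticeModels GrassmannAlgebra Matrix
open Literature.MathematicalPhysics.QuantumLattice.FermiRG
open Summit.HubbardSuperconductivity.HubbardSuperconductivity.Theorems.KLProgrammeLegKernels
open Summit.HubbardSuperconductivity.HubbardSuperconductivity.Theorems.DispersionFlow
open Summit.HubbardSuperconductivity.HubbardSuperconductivity.Theorems.EngineV8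
open Summit.HubbardSuperconductivity.HubbardSuperconductivity.Theorems.KLRegimeWick
open Summit.HubbardSuperconductivity.HubbardSuperconductivity.Theorems.TwoPointAssembly

/-! ## §1 The successor step Prop of the E.5 share and its deferred pair -/

/-- **`E5ShareStep2 P R C u`** — the E.5 classes' share `C` of the cubic budget per step, SUCCESSOR shape ((R55c) J1/J4): for every geometry package
`G` (`G.WF`), every RAISE `Q` of `klEngQ7 P R` ((k1)), under the v2 stub binders (doors `klEngC₃6`, `klEngU₀10`, own CE-aware threshold `U ≤ u Q cc`,
`klEngL₄ P R`, `klEngM₃`; `1 ≤ n ≤ nScales β + 1`, `IsKLRegime`), the history `HistP klPredsV17F2 … G P Q R … 0 n`, `FrameOK … (K_n)` and the class-#1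
MERGED exports `∀ j ≤ n, LevelsUExportMixedAt … (klCU2 P R (klEngQ7 P R)) … j` ⟹ for every `Λ ∈ [Λ_n, Λ_{n−1}]`, every `Qm` and all labels `x y`
over the bare ball: `‖klE5BlockR1 … (K_n) (n−1) Λ Qm x y‖·(Λ_{n−1} − Λ_n) ≤ C·(P.Klam·U)³·2^{−n}`. -/
def E5ShareStep2 (P : SplitConsts) (R : RenConsts) (C : ℝ) (u : EngConsts → ℝ → ℝ) : Prop :=
  ∀ G : GeoConsts, G.WF → ∀ Q : EngConsts, (klEngQ7 P R).IsRaiseOf Q →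
    ∀ cc : ℝ, 0 < cc → cc ≤ klEngC₃6 P R →
      ∀ μ ∈ klWindowC, ∀ U : ℝ, 0 < U → U ≤ klEngU₀10 P R cc → U ≤ u Q cc →
        ∀ β : ℝ, klBetaMin ≤ β → β ≤ Real.exp (cc / U ^ 2) →
          ∀ (L M : ℕ) [NeZero L] [NeZero M], klEngL₄ P R β U ≤ L → klEngM₃ β U L ≤ M →
            ∀ n : ℕ, 1 ≤ n → n ≤ nScales β + 1 → IsKLRegime U cc (-(n : ℤ)) →
              HistP klPredsV17F2 L M G P Q R β U μ 0 n →
                FrameOK R U (nScales β) μ (klFlowFrameU L M β U μ n) →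
                  (∀ j ≤ n, LevelsUExportMixedAt L M (klCU2 P R (klEngQ7 P R)) P β U μ j) →
                    ∀ Λ ∈ Set.Icc (klScale klE0 n) (klScale klE0 (n - 1)), ∀ Qm : TorusSite 2 L,
                      ∀ x y : TorusSite 2 L × MatsubaraIdx M, x.1 ∈ klBall L μ 0 → y.1 ∈ klBall L μ 0 →
                        ‖klE5BlockR1 L M β U μ (klFlowFrameU L M β U μ n) (n - 1) Λ Qm x y‖ * (klScale klE0 (n - 1) - klScale klE0 n) ≤
                          C * (P.Klam * U) ^ 3 * ((2 : ℝ) ^ n)⁻¹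

/-- An admissible successor E.5 package: nonnegative share, threshold positive at every raised package. -/
def IsE5Pkg2 (e : ℝ × (EngConsts → ℝ → ℝ)) : Prop := 0 ≤ e.1 ∧ ∀ Q cc, 0 < e.2 Q cc

/-- The trivial package (share `0`, threshold `1`) is admissible. -/
theorem isE5Pkg2_zero : IsE5Pkg2 (0, fun _ _ => 1) := ⟨le_rfl, fun _ _ => one_pos⟩

section Deferred

variable (P : SplitConsts) (R : RenConsts)

/-- The successor deferred E.5 package: SOME admissible `(C, u)` for which `E5ShareStep2` holds, if one exists, else the trivial package. -/
def klE5Pkg2 : ℝ × (EngConsts → ℝ → ℝ) :=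
  open scoped Classical in
  if h : ∃ e : ℝ × (EngConsts → ℝ → ℝ), IsE5Pkg2 e ∧ E5ShareStep2 P R e.1 e.2 then Classical.choose h else (0, fun _ _ => 1)

/-- **`klE5Raise2 P R`** — the successor deferred E.5 share of `CR` (to be read by the v2 engine package's `CR`-raise, k3c2-p1's Defs successor). -/
def klE5Raise2 : ℝ := (klE5Pkg2 P R).1

/-- **`klE5ShareU2 P R Q cc`** — the successor deferred coupling threshold of the E.5 bound, CE-aware (one of `klEngU₀11`'s `min` terms, at `Q := QT P R`). -/
def klE5ShareU2 : EngConsts → ℝ → ℝ := (klE5Pkg2 P R).2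

/-- The successor deferred package is admissible (unconditionally). -/
theorem isE5Pkg2_klE5Pkg2 : IsE5Pkg2 (klE5Pkg2 P R) := by
  classical
  unfold klE5Pkg2
  split_ifs with h
  · exact (Classical.choose_spec h).1
  · exact isE5Pkg2_zero

/-- `0 ≤ klE5Raise2 P R`. -/
theorem klE5Raise2_nonneg : 0 ≤ klE5Raise2 P R := (isE5Pkg2_klE5Pkg2 P R).1

/-- `0 < klE5ShareU2 P R Q cc` — so a `min` with it keeps a U-door positive. -/
theorem klE5ShareU2_pos (Q : EngConsts) (cc : ℝ) : 0 < klE5ShareU2 P R Q cc := (isE5Pkg2_klE5Pkg2 P R).2 Q cc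

variable {P R}

/-- **The successor step holds for the deferred pair as soon as it holds for some admissible package.** -/
theorem e5ShareStep2_klE5Raise2_of_exists (h : ∃ e : ℝ × (EngConsts → ℝ → ℝ), IsE5Pkg2 e ∧ E5ShareStep2 P R e.1 e.2) :
    E5ShareStep2 P R (klE5Raise2 P R) (klE5ShareU2 P R) := by
  classical
  have hpkg : klE5Pkg2 P R = Classical.choose h := by
    unfold klE5Pkg2
    rw [dif_pos h]
  unfold klE5Raise2 klE5ShareU2
  rw [hpkg]
  exact (Classical.choose_spec h).2

/-- Packaging an explicit witness. -/
theorem e5ShareStep2_klE5Raise2_of {C : ℝ} {u : EngConsts → ℝ → ℝ} (hC : 0 ≤ C) (hu : ∀ Q cc, 0 < u Q cc) (hs : E5ShareStep2 P R C u) :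
    E5ShareStep2 P R (klE5Raise2 P R) (klE5ShareU2 P R) :=
  e5ShareStep2_klE5Raise2_of_exists ⟨(C, u), ⟨hC, hu⟩, hs⟩

/-- Share monotonicity: a larger share (same threshold) still satisfies the successor step. -/
theorem E5ShareStep2.mono {C C' : ℝ} {u : EngConsts → ℝ → ℝ} (h : E5ShareStep2 P R C u) (hCC : C ≤ C') (hP : 0 ≤ P.Klam) :
    E5ShareStep2 P R C' u := by
  intro G hG Q hQ cc hcc hcc3 μ hμ U hU hU10 hUu β hβ hβc L M _ _ hL hM n hn hnN hreg hH hF hX Λ hΛ Qm x y hx hy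
  refine (h G hG Q hQ cc hcc hcc3 μ hμ U hU hU10 hUu β hβ hβc L M hL hM n hn hnN hreg hH hF hX Λ hΛ Qm x y hx hy).trans ?_
  have h1 : (0 : ℝ) ≤ (P.Klam * U) ^ 3 := pow_nonneg (mul_nonneg hP hU.le) 3
  have h2 : (0 : ℝ) ≤ ((2 : ℝ) ^ n)⁻¹ := by positivity
  exact mul_le_mul_of_nonneg_right (mul_le_mul_of_nonneg_right hCC h1) h2

end Deferred

/-! ## §2 The BARE-lines twin, successor shape -/

/-- **`E5ShareStepBare2 P R C u`** — `E5ShareStep2` with the BARE block `klE5BlockBare` (lines `C^K_{>Λ} − C^K_{>Λ_{n−1}}` and their complement, no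
self-energy dressing; carrier built on the full `𝒱_{n−1}[K_n]`). -/
def E5ShareStepBare2 (P : SplitConsts) (R : RenConsts) (C : ℝ) (u : EngConsts → ℝ → ℝ) : Prop :=
  ∀ G : GeoConsts, G.WF → ∀ Q : EngConsts, (klEngQ7 P R).IsRaiseOf Q →
    ∀ cc : ℝ, 0 < cc → cc ≤ klEngC₃6 P R →
      ∀ μ ∈ klWindowC, ∀ U : ℝ, 0 < U → U ≤ klEngU₀10 P R cc → U ≤ u Q cc →
        ∀ β : ℝ, klBetaMin ≤ β → β ≤ Real.exp (cc / U ^ 2) →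
          ∀ (L M : ℕ) [NeZero L] [NeZero M], klEngL₄ P R β U ≤ L → klEngM₃ β U L ≤ M →
            ∀ n : ℕ, 1 ≤ n → n ≤ nScales β + 1 → IsKLRegime U cc (-(n : ℤ)) →
              HistP klPredsV17F2 L M G P Q R β U μ 0 n →
                FrameOK R U (nScales β) μ (klFlowFrameU L M β U μ n) →
                  (∀ j ≤ n, LevelsUExportMixedAt L M (klCU2 P R (klEngQ7 P R)) P β U μ j) →
                    ∀ Λ ∈ Set.Icc (klScale klE0 n) (klScale klE0 (n - 1)), ∀ Qm : TorusSite 2 L,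
                      ∀ x y : TorusSite 2 L × MatsubaraIdx M, x.1 ∈ klBall L μ 0 → y.1 ∈ klBall L μ 0 →
                        ‖klE5BlockBare L M β U μ (klFlowFrameU L M β U μ n) (n - 1) Λ Qm x y‖ * (klScale klE0 (n - 1) - klScale klE0 n) ≤
                          C * (P.Klam * U) ^ 3 * ((2 : ℝ) ^ n)⁻¹

section DeferredBare

variable (P : SplitConsts) (R : RenConsts)

/-- The successor deferred BARE E.5 package. -/
def klE5PkgBare2 : ℝ × (EngConsts → ℝ → ℝ) :=
  open scoped Classical in
  if h : ∃ e : ℝ × (EngConsts → ℝ → ℝ), IsE5Pkg2 e ∧ E5ShareStepBare2 P R e.1 e.2 then Classical.choose h else (0, fun _ _ => 1)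

/-- **`klE5RaiseBare2 P R`** — the successor deferred E.5 share of `CR` in the bare organisation. -/
def klE5RaiseBare2 : ℝ := (klE5PkgBare2 P R).1

/-- **`klE5ShareUBare2 P R Q cc`** — its CE-aware deferred coupling threshold. -/
def klE5ShareUBare2 : EngConsts → ℝ → ℝ := (klE5PkgBare2 P R).2

/-- The successor deferred bare package is admissible (unconditionally). -/
theorem isE5Pkg2_klE5PkgBare2 : IsE5Pkg2 (klE5PkgBare2 P R) := by
  classical
  unfold klE5PkgBare2
  split_ifs with h
  · exact (Classical.choose_spec h).1
  · exact isE5Pkg2_zero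

/-- `0 ≤ klE5RaiseBare2 P R`. -/
theorem klE5RaiseBare2_nonneg : 0 ≤ klE5RaiseBare2 P R := (isE5Pkg2_klE5PkgBare2 P R).1

/-- `0 < klE5ShareUBare2 P R Q cc`. -/
theorem klE5ShareUBare2_pos (Q : EngConsts) (cc : ℝ) : 0 < klE5ShareUBare2 P R Q cc := (isE5Pkg2_klE5PkgBare2 P R).2 Q cc

variable {P R}

/-- The successor bare step holds for the deferred bare pair as soon as it holds for some admissible package. -/
theorem e5ShareStepBare2_klE5RaiseBare2_of_exists (h : ∃ e : ℝ × (EngConsts → ℝ → ℝ), IsE5Pkg2 e ∧ E5ShareStepBare2 P R e.1 e.2) :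
    E5ShareStepBare2 P R (klE5RaiseBare2 P R) (klE5ShareUBare2 P R) := by
  classical
  have hpkg : klE5PkgBare2 P R = Classical.choose h := by
    unfold klE5PkgBare2
    rw [dif_pos h]
  unfold klE5RaiseBare2 klE5ShareUBare2
  rw [hpkg]
  exact (Classical.choose_spec h).2

/-- Packaging an explicit witness (bare, successor). -/
theorem e5ShareStepBare2_klE5RaiseBare2_of {C : ℝ} {u : EngConsts → ℝ → ℝ} (hC : 0 ≤ C) (hu : ∀ Q cc, 0 < u Q cc)
    (hs : E5ShareStepBare2 P R C u) : E5ShareStepBare2 P R (klE5RaiseBare2 P R) (klE5ShareUBare2 P R) :=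
  e5ShareStepBare2_klE5RaiseBare2_of_exists ⟨(C, u), ⟨hC, hu⟩, hs⟩

end DeferredBare

end Summit.HubbardSuperconductivity.HubbardSuperconductivity.Theorems.KLRegimeSplit

end
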